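import Summits.QuantumFields.YangMills.Theorems.LuscherReductionRunningReductionOneSiteTailDoors
import Summits.QuantumFields.YangMills.Theorems.LuscherReductionRunningReductionOneSiteTailHS
import Summits.QuantumFields.YangMills.Theorems.LuscherReductionOneSiteLevelsVariational
import HarnessLib

/-!
# Item stmt-QuantumFields-20204 `OneSiteTail`: the SOCKETS — with the Hilbert–Schmidt input discharged, ONE analytic hypothesis closes the item

Fourth glue module (seat ym-luscher-20007-p2 g4).  The polynomial Hilbert–Schmidt ratio bound (input S1 of the ideator-2 split) is a TREE THEOREM
since p514757 (`OST.hs_ratio`, seat ym-luscher-20007-p1 g4: `Σ_{j≤n} x_j(B)² ≤ C·B⁹`, Fin-sum form); this module feeds it into the doors of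
`…OneSiteTailDoors.lean`, so that EACH of the following single hypotheses yields THE ROUTE DECL `Theses.LuscherReduction.OneSiteTail` by name
(`x_k(B) = levelValue su2Rep 1 B k / levelValue su2Rep 1 B 0`, `λ_b = bareLambda`, `E_{k+1} = physLevel (k+1)`):

* `oneSiteTail_route_of_windowFloor` — truncated domination: `∀ c₁>0 ∃ g ≥ 0` Laplace-summable, `λ_k ≤ e^{−λ_b·min(g k, c₁ log B)} λ_0`;
* `oneSiteTail_route_of_levelWindow` / `…_of_powWindow` / `…_of_affinePowWindow` / `…_of_affineLevelWindow` — window floors in LEVEL currency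
  (`A·E + C₀ < E_{k+1} ⟹ λ_k ≤ e^{−λ_b E} λ_0` for `E` in a log or power window; the shape seat ym-luscher-20007-p1 g4 is assembling);
* `oneSiteTail_route_of_lowCount` — window floors in COUNT currency (`C(1+E)^p ≤ k ⟹ λ_k ≤ e^{−λ_b E} λ_0`, the shape a dimension count via
  `finrank_le_dimBound` delivers), through the inverse profile `g(k) = max 0 ((k/C)^{1/(p+1)} − 1)` (`windowFloor_of_lowCount`; proof = ym-cruxidea-19978-2
  g11's `OSTailDoors.truncatedDomination_of_lowCount` of the crux file `Cruxes/RunningReduction/Lines/onesite_tail_doors.lean`, ported def-free);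
* `oneSiteTail_route_of_femtoSubspaceBound` — the same count in the variational «no intruders» currency of the tree door
  `levelValue_le_of_forall_rayleigh_le` (`n ≤ C(1+E)^p` physical constraint functions kill every Rayleigh quotient above `e^{−λ_b E} λ_0`).

HONEST FRAMING: glue only; the window floor / count itself (ONE's AbsUpper lane run k-uniformly on the femto zone) is NOT proved here; femto rung
R2b1 (one-site lattice quantum mechanics of the three-matrix `SU(2)` model); not infinite volume, not a mass gap, not Clay.
References: Lüscher 1983 §1; Simon 1983 (Ann. Phys. 146) Thm. 1.1 / Cor. 4; Reed–Simon IV Thm. XIII.1; Reed–Simon I Thm. VI.22.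
-/

set_option autoImplicit false

noncomputable section

open Filter Topology
open Literature.MathematicalPhysics.QuantumFieldTheory
open Literature.MathematicalPhysics.QuantumLattice
open Literature.Analysis.OperatorTheory.YMMatrixModel

namespace Summit.QuantumFields.YangMills.Theorems.FemtoTransferGap.OSTail

/-! ### §1 The Hilbert–Schmidt input, discharged (tree `OST.hs_ratio`, seat ym-luscher-20007-p1 g4) -/

/-- **(HS) in the doors' shape**, from the tree's `OST.hs_ratio` (Fin-sum form `Σ_{j≤n}` ⟹ `Finset.range` form `Σ_{j<n}`). -/
theorem hsRatio_range : ∃ C : ℝ, ∃ q : ℕ, ∃ B0 : ℝ, ∀ B : ℝ, B0 ≤ B → ∀ n : ℕ,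
    ∑ j ∈ Finset.range n, (levelValue su2Rep 1 B j / levelValue su2Rep 1 B 0) ^ 2 ≤ C * B ^ q := by
  obtain ⟨C, B0, h⟩ := OST.hs_ratio
  refine ⟨max C 0, 9, max B0 0, fun B hB n => ?_⟩
  have hB0 : B0 ≤ B := le_trans (le_max_left _ _) hB
  have hBnn : 0 ≤ B := le_trans (le_max_right _ _) hB
  have hCB : C * B ^ 9 ≤ max C 0 * B ^ 9 := mul_le_mul_of_nonneg_right (le_max_left _ _) (pow_nonneg hBnn 9)
  cases n with
  | zero => simpa using mul_nonneg (le_max_right C 0) (pow_nonneg hBnn 9)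
  | succ k =>
    have h1 := h B hB0 k
    rw [Fin.sum_univ_eq_sum_range (fun j => (levelValue su2Rep 1 B j / levelValue su2Rep 1 B 0) ^ 2) (k + 1)] at h1
    exact h1.trans hCB

/-! ### §2 Sockets in floor / level currency -/

/-- ★ **Truncated domination (windowed Laplace-summable floor) ⟹ `Theses.LuscherReduction.OneSiteTail`.** -/
theorem oneSiteTail_route_of_windowFloor
    (hW : ∀ c₁ : ℝ, 0 < c₁ → ∃ g : ℕ → ℝ, (∀ k, 0 ≤ g k) ∧
      (∀ t : ℝ, 0 < t → Summable fun k : ℕ => Real.exp (-t * g k)) ∧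
      ∃ B0 : ℝ, ∀ B : ℝ, B0 ≤ B → ∀ k : ℕ,
        levelValue su2Rep 1 B k ≤ Real.exp (-(bareLambda B * min (g k) (c₁ * Real.log B))) * levelValue su2Rep 1 B 0) :
    Summit.QuantumFields.YangMills.Theses.LuscherReduction.OneSiteTail :=
  oneSiteTail_route_of_hs_of_windowFloor hsRatio_range hW

/-- ★ **Window floor in level currency (log windows) ⟹ `Theses.LuscherReduction.OneSiteTail`.** -/
theorem oneSiteTail_route_of_levelWindow
    (hL : ∀ c₁ : ℝ, 0 < c₁ → ∃ C₀ B0 : ℝ, ∀ B : ℝ, B0 ≤ B → ∀ E : ℝ, 0 ≤ E → E ≤ c₁ * Real.log B →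
      ∀ k : ℕ, E + C₀ < physLevel (k + 1) →
        levelValue su2Rep 1 B k ≤ Real.exp (-(bareLambda B * E)) * levelValue su2Rep 1 B 0) :
    Summit.QuantumFields.YangMills.Theses.LuscherReduction.OneSiteTail :=
  oneSiteTail_route_of_hs_of_levelWindow hsRatio_range hL

/-- ★ **Window floor in level currency (power window `c_w·B^a`) ⟹ `Theses.LuscherReduction.OneSiteTail`.** -/
theorem oneSiteTail_route_of_powWindow {a c_w : ℝ} (ha : 0 < a) (hc : 0 < c_w)
    (hL : ∃ C₀ B0 : ℝ, ∀ B : ℝ, B0 ≤ B → ∀ E : ℝ, 0 ≤ E → E ≤ c_w * B ^ a →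
      ∀ k : ℕ, E + C₀ < physLevel (k + 1) →
        levelValue su2Rep 1 B k ≤ Real.exp (-(bareLambda B * E)) * levelValue su2Rep 1 B 0) :
    Summit.QuantumFields.YangMills.Theses.LuscherReduction.OneSiteTail :=
  oneSiteTail_route_of_hs_of_powWindow ha hc hsRatio_range hL

/-- ★ **AFFINE window floor in level currency (power window; any slope `A > 0`) ⟹ `Theses.LuscherReduction.OneSiteTail`.** -/
theorem oneSiteTail_route_of_affinePowWindow {A a c_w : ℝ} (hA : 0 < A) (ha : 0 < a) (hc : 0 < c_w)
    (hL : ∃ C₀ B0 : ℝ, ∀ B : ℝ, B0 ≤ B → ∀ E : ℝ, 0 ≤ E → E ≤ c_w * B ^ a →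
      ∀ k : ℕ, A * E + C₀ < physLevel (k + 1) →
        levelValue su2Rep 1 B k ≤ Real.exp (-(bareLambda B * E)) * levelValue su2Rep 1 B 0) :
    Summit.QuantumFields.YangMills.Theses.LuscherReduction.OneSiteTail :=
  oneSiteTail_route_of_hs_of_affinePowWindow hA ha hc hsRatio_range hL

/-- ★ **AFFINE window floor in level currency (log windows; any slope `A > 0`) ⟹ `Theses.LuscherReduction.OneSiteTail`.** -/
theorem oneSiteTail_route_of_affineLevelWindow {A : ℝ} (hA : 0 < A)
    (hL : ∀ c₁ : ℝ, 0 < c₁ → ∃ C₀ B0 : ℝ, ∀ B : ℝ, B0 ≤ B → ∀ E : ℝ, 0 ≤ E → E ≤ c₁ * Real.log B →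
      ∀ k : ℕ, A * E + C₀ < physLevel (k + 1) →
        levelValue su2Rep 1 B k ≤ Real.exp (-(bareLambda B * E)) * levelValue su2Rep 1 B 0) :
    Summit.QuantumFields.YangMills.Theses.LuscherReduction.OneSiteTail :=
  oneSiteTail_route_of_hs_of_affineLevelWindow hA hsRatio_range hL

/-! ### §3 Sockets in count currency (ym-cruxidea-19978-2 g11's count doors, def-free) -/

/-- The stretched-exponential bound behind the Laplace summability of the inverse profile `(n/C)^{1/p} − 1`:
`e^{−t((n/C)^{1/p} − 1)} ≤ e^t (2p)! C² t^{−2p} / n²` (`n ≥ 1`), from `x^m/m! ≤ e^x` (proof: ideator-2 g11, verbatim). -/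
theorem exp_neg_rpow_inv_le {C t : ℝ} (hC : 0 < C) (ht : 0 < t) (p : ℕ) (hp : p ≠ 0) (n : ℕ) (hn : 1 ≤ n) :
    Real.exp (-t * (((n : ℝ) / C) ^ ((p : ℝ)⁻¹) - 1))
      ≤ Real.exp t * (((2 * p).factorial : ℝ) * C ^ 2 / t ^ (2 * p)) * ((n : ℝ) ^ 2)⁻¹ := by
  set y : ℝ := ((n : ℝ) / C) ^ ((p : ℝ)⁻¹) with hy
  have hnpos : (0 : ℝ) < n := by
    have h : 0 < n := by omega
    exact_mod_cast h
  have hnC : 0 < (n : ℝ) / C := div_pos hnpos hC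
  have hypos : 0 < y := Real.rpow_pos_of_pos hnC _
  have hyp : y ^ p = (n : ℝ) / C := Real.rpow_inv_natCast_pow hnC.le hp
  have hty : 0 < t * y := mul_pos ht hypos
  have h1 : Real.exp (-t * (y - 1)) = Real.exp t * Real.exp (-(t * y)) := by
    rw [← Real.exp_add]; congr 1; ring
  have h2 : Real.exp (-(t * y)) ≤ ((2 * p).factorial : ℝ) / (t * y) ^ (2 * p) := by
    have hfac := Real.pow_div_factorial_le_exp (t * y) hty.le (2 * p)
    have hpos : 0 < (t * y) ^ (2 * p) / ((2 * p).factorial : ℝ) := by positivity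
    rw [Real.exp_neg]
    calc (Real.exp (t * y))⁻¹ ≤ ((t * y) ^ (2 * p) / ((2 * p).factorial : ℝ))⁻¹ := inv_anti₀ hpos hfac
      _ = ((2 * p).factorial : ℝ) / (t * y) ^ (2 * p) := by rw [inv_div]
  have h3 : (t * y) ^ (2 * p) = t ^ (2 * p) * ((n : ℝ) ^ 2 / C ^ 2) := by
    rw [mul_pow, pow_mul' y 2 p, hyp, div_pow]
  have h4 : ((2 * p).factorial : ℝ) / (t * y) ^ (2 * p) = (((2 * p).factorial : ℝ) * C ^ 2 / t ^ (2 * p)) * ((n : ℝ) ^ 2)⁻¹ := by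
    rw [h3]
    have htne : t ≠ 0 := ht.ne'
    have hnne : (n : ℝ) ≠ 0 := hnpos.ne'
    have hCne : C ≠ 0 := hC.ne'
    field_simp
  calc Real.exp (-t * (y - 1)) = Real.exp t * Real.exp (-(t * y)) := h1
    _ ≤ Real.exp t * (((2 * p).factorial : ℝ) / (t * y) ^ (2 * p)) := mul_le_mul_of_nonneg_left h2 (Real.exp_pos t).le
    _ = Real.exp t * (((2 * p).factorial : ℝ) * C ^ 2 / t ^ (2 * p)) * ((n : ℝ) ^ 2)⁻¹ := by rw [h4]; ring

/-- ★ **Count ⟹ truncated domination** (window floor in COUNT currency ⟹ windowed Laplace-summable floor), inverse profile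
`g(k) = max 0 ((k/C)^{1/(p+1)} − 1)` (proof: ideator-2 g11's `truncatedDomination_of_lowCount`, verbatim). -/
theorem windowFloor_of_lowCount
    (h : ∀ c₁ : ℝ, 0 < c₁ → ∃ C : ℝ, ∃ p : ℕ, ∃ B0 : ℝ, 0 < C ∧ ∀ B : ℝ, B0 ≤ B → ∀ E : ℝ, 0 ≤ E → E ≤ c₁ * Real.log B →
      ∀ k : ℕ, C * (1 + E) ^ p ≤ (k : ℝ) →
        levelValue su2Rep 1 B k ≤ Real.exp (-(bareLambda B * E)) * levelValue su2Rep 1 B 0) :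
    ∀ c₁ : ℝ, 0 < c₁ → ∃ g : ℕ → ℝ, (∀ k, 0 ≤ g k) ∧
      (∀ t : ℝ, 0 < t → Summable fun k : ℕ => Real.exp (-t * g k)) ∧
      ∃ B0 : ℝ, ∀ B : ℝ, B0 ≤ B → ∀ k : ℕ,
        levelValue su2Rep 1 B k ≤ Real.exp (-(bareLambda B * min (g k) (c₁ * Real.log B))) * levelValue su2Rep 1 B 0 := by
  intro c₁ hc₁
  obtain ⟨C, p, B0, hC, hcount⟩ := h c₁ hc₁
  set q : ℕ := p + 1 with hq
  have hq0 : q ≠ 0 := Nat.succ_ne_zero p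
  let g : ℕ → ℝ := fun k => max 0 (((k : ℝ) / C) ^ ((q : ℝ)⁻¹) - 1)
  refine ⟨g, fun k => le_max_left _ _, fun t ht => ?_, max B0 1, fun B hB k => ?_⟩
  · set M : ℝ := Real.exp t * (((2 * q).factorial : ℝ) * C ^ 2 / t ^ (2 * q)) with hM
    have hbound : ∀ k : ℕ, Real.exp (-t * g (k + 1)) ≤ M * ((((k + 1 : ℕ) : ℝ)) ^ 2)⁻¹ := by
      intro k
      have hgk : ((((k + 1 : ℕ) : ℝ)) / C) ^ ((q : ℝ)⁻¹) - 1 ≤ g (k + 1) := le_max_right _ _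
      calc Real.exp (-t * g (k + 1)) ≤ Real.exp (-t * (((((k + 1 : ℕ) : ℝ)) / C) ^ ((q : ℝ)⁻¹) - 1)) := by
            refine Real.exp_le_exp.2 ?_
            have := mul_le_mul_of_nonneg_left hgk ht.le
            linarith
        _ ≤ M * ((((k + 1 : ℕ) : ℝ)) ^ 2)⁻¹ := exp_neg_rpow_inv_le hC ht q hq0 (k + 1) (by omega)
    have hmaj : Summable (fun k : ℕ => M * ((((k + 1 : ℕ) : ℝ)) ^ 2)⁻¹) := by
      have hs : Summable (fun n : ℕ => M * (((n : ℝ)) ^ 2)⁻¹) := (Real.summable_nat_pow_inv.2 (by norm_num)).mul_left M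
      exact (summable_nat_add_iff (f := fun n : ℕ => M * (((n : ℝ)) ^ 2)⁻¹) 1).2 hs
    have hshift : Summable (fun k : ℕ => Real.exp (-t * g (k + 1))) :=
      Summable.of_nonneg_of_le (fun k => (Real.exp_pos _).le) hbound hmaj
    exact (summable_nat_add_iff (f := fun k : ℕ => Real.exp (-t * g k)) 1).1 hshift
  · have hB0 : B0 ≤ B := le_trans (le_max_left _ _) hB
    have hB1 : (1 : ℝ) ≤ B := le_trans (le_max_right _ _) hB
    have hBpos : 0 < B := by linarith
    have hlogB : 0 ≤ c₁ * Real.log B := mul_nonneg hc₁.le (Real.log_nonneg hB1)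
    have hkC : 0 ≤ (k : ℝ) / C := div_nonneg (Nat.cast_nonneg k) hC.le
    set y : ℝ := ((k : ℝ) / C) ^ ((q : ℝ)⁻¹) with hy
    have hyq : y ^ q = (k : ℝ) / C := Real.rpow_inv_natCast_pow hkC hq0
    have hgk : g k = max 0 (y - 1) := rfl
    rcases le_total y 1 with hy1 | hy1
    · have hg0 : g k = 0 := by rw [hgk]; exact max_eq_left (by linarith)
      have hmin : min (g k) (c₁ * Real.log B) = 0 := by rw [hg0]; exact min_eq_left hlogB
      rw [hmin, mul_zero, neg_zero, Real.exp_zero, one_mul]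
      exact levelValue_le_of_le hBpos (Nat.zero_le k)
    · have hgk' : g k = y - 1 := by rw [hgk]; exact max_eq_right (by linarith)
      set m : ℝ := min (g k) (c₁ * Real.log B) with hm
      have hm0 : 0 ≤ m := le_min (le_max_left _ _) hlogB
      have hmle : m ≤ c₁ * Real.log B := min_le_right _ _
      have hmg : m ≤ g k := min_le_left _ _
      have h1m : 1 + m ≤ y := by linarith
      have hpow : (1 + m) ^ q ≤ (k : ℝ) / C := by
        rw [← hyq]; exact pow_le_pow_left₀ (by linarith) h1m q
      have hkq : C * (1 + m) ^ q ≤ (k : ℝ) := by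
        have h1 := mul_le_mul_of_nonneg_left hpow hC.le
        have h2 : C * ((k : ℝ) / C) = k := by field_simp
        linarith
      have hkp : C * (1 + m) ^ p ≤ (k : ℝ) := by
        refine le_trans (mul_le_mul_of_nonneg_left ?_ hC.le) hkq
        exact pow_le_pow_right₀ (by linarith) (Nat.le_succ p)
      exact hcount B hB0 m hm0 hmle k hkp

/-- ★ **Window floor in COUNT currency ⟹ `Theses.LuscherReduction.OneSiteTail`.** -/
theorem oneSiteTail_route_of_lowCount
    (h : ∀ c₁ : ℝ, 0 < c₁ → ∃ C : ℝ, ∃ p : ℕ, ∃ B0 : ℝ, 0 < C ∧ ∀ B : ℝ, B0 ≤ B → ∀ E : ℝ, 0 ≤ E → E ≤ c₁ * Real.log B →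
      ∀ k : ℕ, C * (1 + E) ^ p ≤ (k : ℝ) →
        levelValue su2Rep 1 B k ≤ Real.exp (-(bareLambda B * E)) * levelValue su2Rep 1 B 0) :
    Summit.QuantumFields.YangMills.Theses.LuscherReduction.OneSiteTail :=
  oneSiteTail_route_of_windowFloor (windowFloor_of_lowCount h)

/-- **Variational («no intruders») count ⟹ level count**, through the tree door `levelValue_le_of_forall_rayleigh_le` and monotonicity in the
level (proof: ideator-2 g11's `lowCount_of_femtoSubspaceBound`, verbatim). -/
theorem lowCount_of_femtoSubspaceBound
    (h : ∀ c₁ : ℝ, 0 < c₁ → ∃ C : ℝ, ∃ p : ℕ, ∃ B0 : ℝ, 0 < C ∧ ∀ B : ℝ, B0 ≤ B → ∀ E : ℝ, 0 ≤ E → E ≤ c₁ * Real.log B →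
      ∃ n : ℕ, (n : ℝ) ≤ C * (1 + E) ^ p ∧ ∃ φs : Fin n → (GaugeConfig 3 1 SU2 → ℝ), (∀ i, IsPhys (φs i)) ∧
        ∀ ψ : GaugeConfig 3 1 SU2 → ℝ, IsPhys ψ → (∀ i, l2 ψ (φs i) = 0) → 0 < l2 ψ ψ →
          qform su2Rep B ψ ψ ≤ (Real.exp (-(bareLambda B * E)) * levelValue su2Rep 1 B 0) * l2 ψ ψ) :
    ∀ c₁ : ℝ, 0 < c₁ → ∃ C : ℝ, ∃ p : ℕ, ∃ B0 : ℝ, 0 < C ∧ ∀ B : ℝ, B0 ≤ B → ∀ E : ℝ, 0 ≤ E → E ≤ c₁ * Real.log B →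
      ∀ k : ℕ, C * (1 + E) ^ p ≤ (k : ℝ) →
        levelValue su2Rep 1 B k ≤ Real.exp (-(bareLambda B * E)) * levelValue su2Rep 1 B 0 := by
  intro c₁ hc₁
  obtain ⟨C, p, B0, hC, hB⟩ := h c₁ hc₁
  refine ⟨C, p, max B0 1, hC, fun B hBB E hE0 hE k hk => ?_⟩
  have hB0 : B0 ≤ B := le_trans (le_max_left _ _) hBB
  have hB1 : (1 : ℝ) ≤ B := le_trans (le_max_right _ _) hBB
  have hBpos : 0 < B := by linarith
  obtain ⟨n, hn, φs, hφ, hray⟩ := hB B hB0 E hE0 hE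
  have hs0 : 0 ≤ Real.exp (-(bareLambda B * E)) * levelValue su2Rep 1 B 0 :=
    mul_nonneg (Real.exp_pos _).le (levelValue_su2Rep_nonneg 1 hBpos.le 0)
  have hn' : levelValue su2Rep 1 B n ≤ Real.exp (-(bareLambda B * E)) * levelValue su2Rep 1 B 0 :=
    levelValue_le_of_forall_rayleigh_le su2Rep B hs0 φs hφ hray
  have hnk' : (n : ℝ) ≤ k := hn.trans hk
  have hnk : n ≤ k := by exact_mod_cast hnk'
  exact (levelValue_le_of_le hBpos hnk).trans hn'

/-- ★ **Variational («no intruders») femto-zone count ⟹ `Theses.LuscherReduction.OneSiteTail`.** -/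
theorem oneSiteTail_route_of_femtoSubspaceBound
    (h : ∀ c₁ : ℝ, 0 < c₁ → ∃ C : ℝ, ∃ p : ℕ, ∃ B0 : ℝ, 0 < C ∧ ∀ B : ℝ, B0 ≤ B → ∀ E : ℝ, 0 ≤ E → E ≤ c₁ * Real.log B →
      ∃ n : ℕ, (n : ℝ) ≤ C * (1 + E) ^ p ∧ ∃ φs : Fin n → (GaugeConfig 3 1 SU2 → ℝ), (∀ i, IsPhys (φs i)) ∧
        ∀ ψ : GaugeConfig 3 1 SU2 → ℝ, IsPhys ψ → (∀ i, l2 ψ (φs i) = 0) → 0 < l2 ψ ψ →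
          qform su2Rep B ψ ψ ≤ (Real.exp (-(bareLambda B * E)) * levelValue su2Rep 1 B 0) * l2 ψ ψ) :
    Summit.QuantumFields.YangMills.Theses.LuscherReduction.OneSiteTail :=
  oneSiteTail_route_of_lowCount (lowCount_of_femtoSubspaceBound h)

end Summit.QuantumFields.YangMills.Theorems.FemtoTransferGap.OSTail

end
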